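import Summits.CriticalPhenomena.PercolationContinuityZ3.Theorems.PercNearOneGluingNoHeavyLowerTailThreePointCPIPuncturedDefs
import HarnessLib

/-!
# The far flip `ι₀`: an involution settling the one-sided part of `(★★)` (3-point CPI₂)

Crux `stmt-CriticalPhenomena-4575`, route `PercNearOneGluingNoHeavy`, fibre line (facecert gen 27; memo
`prim-l12/prim-facecert/FINDING-gen27-PUNCTURED-INVOLUTION.md`; definitions in `…ThreePointCPIPuncturedDefs`).
With `Y = c ↔ {s,b}` (open), `J = s ↔ b` (open), `D = s ↮ b` (closed graph of `z`), the one-colour inequality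
`(★★) #{Y ∧ D ∧ J ∧ ¬(Y□D)} ≤ #{Y ∧ ¬J ∧ ¬D}` implies CPI₂ (`…ThreePointCPIReimer.threePoint_cpi_two_of_starstar`).
Let `R(z)` be the punctured open cluster of `c` (open paths from `c` avoiding `s, b`) and `ι₀(z)` the far flip
(complement every label with no endpoint in `R(z)`).

* `preach_farFlip_iff`, `farFlip_farFlip` — `ι₀` preserves `R` and is an INVOLUTION of `{0,1}^α`.
* `terminal_of_open_label` — "no entry": an open label with exactly one endpoint in `R(z)` ends at a terminal.
* `farFlip_mem_X5` — **THEOREM A**: if `c ∉ {s,b}`, `z ∈ Y ∧ J ∧ D` and `R(z)` is ONE-SIDED (not open-adjacent to both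
  terminals) then `ι₀(z) ∈ Y ∧ ¬J ∧ ¬D`.  Proof: the open `c`–terminal path inside `R` is untouched; an `ι₀`-open `s–b` path
  cannot enter `R` (no entry + one-sidedness), so it lies outside `R` and is `z`-closed, contradicting `D`; the `z`-open `s–b`
  path likewise avoids `R` and becomes `ι₀`-closed.  `¬(Y□D)` is NOT used.
* `oneSided_of_not_reachable` — every `z ∈ Y ∧ ¬J` is one-sided.

The counting consequences (`#{Y∧J∧D∧one-sided} ≤ #{Y∧¬J∧¬D}` and the reduction of `(★★)`/CPI₂ to the two-sided residual)
are in `…ThreePointCPIPuncturedCount`.  Census (facecert gen 27, kit j250194 + local): the one-sided class is ≈ 92 % of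
`X1 = Y∧D∧J∧¬(Y□D)` on all multigraphs with `n ≤ 6`, `m ≤ 8`.
-/

namespace Summit.CriticalPhenomena.PercolationContinuityZ3.Theorems.ThreePointCPIPunctured

open Finset Literature.Probability.Percolation

variable {V α : Type*}

/-! ### The punctured cluster -/

section Basic

variable (ends : α → Sym2 V) (s b c : V)

/-- `c` lies in its own punctured cluster. [this work] -/
theorem preach_self (z : α → Bool) : PReach ends s b c z c := SimpleGraph.Reachable.refl _

/-- The terminals have no incident edges in the punctured open graph. [this work] -/
theorem not_punct_adj_terminal (z : α → Bool) {t x : V} (ht : t = s ∨ t = b) :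
    ¬ (openGraph (punct ends s b z)).Adj t x := by
  intro h
  rw [openGraph_adj] at h
  obtain ⟨⟨_, hs, hb⟩, _⟩ := h
  rcases ht with rfl | rfl
  · exact hs (Sym2.mem_mk_left _ _)
  · exact hb (Sym2.mem_mk_left _ _)

/-- A terminal is punctured-reachable from `c` only if it equals `c`. [this work] -/
theorem eq_of_preach_terminal (z : α → Bool) {t : V} (ht : t = s ∨ t = b)
    (h : PReach ends s b c z t) : c = t := by
  obtain ⟨p⟩ := h
  cases hp : p.reverse with
  | nil => rfl
  | cons hadj _ => exact absurd hadj (not_punct_adj_terminal ends s b z ht)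

/-- If `c` is not a terminal, no vertex of its punctured cluster is a terminal. [this work] -/
theorem preach_ne (z : α → Bool) (hcs : c ≠ s) (hcb : c ≠ b) {v : V}
    (h : PReach ends s b c z v) : v ≠ s ∧ v ≠ b := by
  refine ⟨fun hv => hcs ?_, fun hv => hcb ?_⟩
  · have := eq_of_preach_terminal ends s b c z (t := v) (Or.inl hv) h
    rw [this, hv]
  · have := eq_of_preach_terminal ends s b c z (t := v) (Or.inr hv) h
    rw [this, hv]

/-- **Growth step.** An open label from a vertex of the punctured cluster to a non-terminal vertex
extends the punctured cluster. [this work] -/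
theorem preach_step (z : α → Bool) (hcs : c ≠ s) (hcb : c ≠ b) {a : α} {u w : V}
    (ha : z a = true) (hends : ends a = s(u, w)) (hu : PReach ends s b c z u)
    (hws : w ≠ s) (hwb : w ≠ b) : PReach ends s b c z w := by
  by_cases huw : u = w
  · exact huw ▸ hu
  obtain ⟨hus, hub⟩ := preach_ne ends s b c z hcs hcb hu
  refine hu.trans (SimpleGraph.Adj.reachable ?_)
  rw [openGraph_adj]
  refine ⟨⟨⟨a, ha, hends⟩, ?_, ?_⟩, huw⟩
  · rw [Sym2.mem_iff]; rintro (rfl | rfl); exacts [hus rfl, hws rfl]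
  · rw [Sym2.mem_iff]; rintro (rfl | rfl); exacts [hub rfl, hwb rfl]

/-- **No entry.** An open label with one endpoint inside the punctured cluster and the other outside
has a terminal as its outer endpoint. [this work] -/
theorem terminal_of_open_label (z : α → Bool) (hcs : c ≠ s) (hcb : c ≠ b) {a : α} {u w : V}
    (ha : z a = true) (hends : ends a = s(u, w)) (hu : PReach ends s b c z u)
    (hw : ¬ PReach ends s b c z w) : w = s ∨ w = b := by
  by_contra h
  have h' : w ≠ s ∧ w ≠ b := not_or.mp h
  exact hw (preach_step ends s b c z hcs hcb ha hends hu h'.1 h'.2)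

open Classical in
/-- The far flip keeps every label touching the punctured cluster. [this work] -/
theorem farFlip_of_touch (z : α → Bool) {a : α} (h : Touch ends s b c z a) :
    farFlip ends s b c z a = z a := by
  simp only [farFlip, if_pos h]

open Classical in
/-- The far flip complements every label not touching the punctured cluster. [this work] -/
theorem farFlip_of_not_touch (z : α → Bool) {a : α} (h : ¬ Touch ends s b c z a) :
    farFlip ends s b c z a = !z a := by
  simp only [farFlip, if_neg h]

/-- Transfer of punctured walks: if `z₁` agrees with `z` on every label touching `R(z)` and is open
only where ... (auxiliary): a walk in the punctured graph of `x₁` starting inside `R(z)` stays inside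
`R(z)` and is a walk of the punctured graph of `x₂`, provided `x₁ a = true → Touch z a → z a = true ∧ x₂ a = true`.
[this work] -/
theorem preach_transfer (z x₁ x₂ : α → Bool) (hcs : c ≠ s) (hcb : c ≠ b)
    (H : ∀ a, x₁ a = true → Touch ends s b c z a → z a = true ∧ x₂ a = true)
    {u v : V} (p : (openGraph (punct ends s b x₁)).Walk u v) (hu : PReach ends s b c z u) :
    PReach ends s b c z v ∧ (openGraph (punct ends s b x₂)).Reachable u v := by
  induction p with
  | nil => exact ⟨hu, SimpleGraph.Reachable.refl _⟩
  | @cons u x v hadj p ih =>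
    rw [openGraph_adj] at hadj
    obtain ⟨⟨⟨a, ha, hends⟩, hxs, hxb⟩, hux⟩ := hadj
    have htouch : Touch ends s b c z a := ⟨u, by rw [hends]; exact Sym2.mem_mk_left _ _, hu⟩
    obtain ⟨hza, hx₂a⟩ := H a ha htouch
    have hx : PReach ends s b c z x :=
      preach_step ends s b c z hcs hcb hza hends hu
        (fun h => hxs (by rw [h]; exact Sym2.mem_mk_right _ _))
        (fun h => hxb (by rw [h]; exact Sym2.mem_mk_right _ _))
    obtain ⟨hv, hreach⟩ := ih hx
    refine ⟨hv, SimpleGraph.Reachable.trans (SimpleGraph.Adj.reachable ?_) hreach⟩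
    rw [openGraph_adj]
    exact ⟨⟨⟨a, hx₂a, hends⟩, hxs, hxb⟩, hux⟩

/-- **The far flip preserves the punctured cluster.** [this work] -/
theorem preach_farFlip_iff (z : α → Bool) (hcs : c ≠ s) (hcb : c ≠ b) (v : V) :
    PReach ends s b c (farFlip ends s b c z) v ↔ PReach ends s b c z v := by
  constructor
  · rintro ⟨p⟩
    refine (preach_transfer ends s b c z (farFlip ends s b c z) z hcs hcb ?_ p
      (preach_self ends s b c z)).1
    intro a ha ht
    rw [farFlip_of_touch ends s b c z ht] at ha
    exact ⟨ha, ha⟩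
  · rintro ⟨p⟩
    refine (preach_transfer ends s b c z z (farFlip ends s b c z) hcs hcb ?_ p
      (preach_self ends s b c z)).2
    intro a ha ht
    exact ⟨ha, by rw [farFlip_of_touch ends s b c z ht]; exact ha⟩

/-- The far flip preserves the set of labels touching the punctured cluster. [this work] -/
theorem touch_farFlip_iff (z : α → Bool) (hcs : c ≠ s) (hcb : c ≠ b) (a : α) :
    Touch ends s b c (farFlip ends s b c z) a ↔ Touch ends s b c z a := by
  simp only [Touch, preach_farFlip_iff ends s b c z hcs hcb]

/-- **`ι₀` is an involution.** [this work] -/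
theorem farFlip_farFlip (z : α → Bool) (hcs : c ≠ s) (hcb : c ≠ b) :
    farFlip ends s b c (farFlip ends s b c z) = z := by
  funext a
  by_cases h : Touch ends s b c z a
  · rw [farFlip_of_touch ends s b c _ ((touch_farFlip_iff ends s b c z hcs hcb a).2 h),
      farFlip_of_touch ends s b c z h]
  · rw [farFlip_of_not_touch ends s b c _ (fun h' => h ((touch_farFlip_iff ends s b c z hcs hcb a).1 h')),
      farFlip_of_not_touch ends s b c z h, Bool.not_not]

/-- The far flip preserves open ports. [this work] -/
theorem portOpen_farFlip_iff (z : α → Bool) (hcs : c ≠ s) (hcb : c ≠ b) (t : V) :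
    PortOpen ends s b c (farFlip ends s b c z) t ↔ PortOpen ends s b c z t := by
  constructor
  · rintro ⟨a, ha, ht, htouch⟩
    have htz := (touch_farFlip_iff ends s b c z hcs hcb a).1 htouch
    exact ⟨a, by rw [farFlip_of_touch ends s b c z htz] at ha; exact ha, ht, htz⟩
  · rintro ⟨a, ha, ht, htouch⟩
    exact ⟨a, by rw [farFlip_of_touch ends s b c z htouch]; exact ha, ht,
      (touch_farFlip_iff ends s b c z hcs hcb a).2 htouch⟩

/-- The far flip preserves one-sidedness. [this work] -/
theorem oneSided_farFlip_iff (z : α → Bool) (hcs : c ≠ s) (hcb : c ≠ b) :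
    OneSided ends s b c (farFlip ends s b c z) ↔ OneSided ends s b c z := by
  simp only [OneSided, portOpen_farFlip_iff ends s b c z hcs hcb]

end Basic


/-! ### Validity of the far flip (Theorem A) -/

section Validity

variable (ends : α → Sym2 V) (s b c : V)

/-- From an open port the port `c` reaches that terminal in the open graph. [this work] -/
theorem reachable_of_portOpen (z : α → Bool) {t : V}
    (ht : PortOpen ends s b c z t) : (openGraph (labelledOpen ends z)).Reachable c t := by
  obtain ⟨a, ha, hta, v, hva, hv⟩ := ht
  -- c reaches v in the punctured graph, a subgraph of the open graph
  have hcv : (openGraph (labelledOpen ends z)).Reachable c v := by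
    obtain ⟨p⟩ := hv
    refine ⟨p.transfer (openGraph (labelledOpen ends z)) fun e he => ?_⟩
    have heG := p.edges_subset_edgeSet he
    rw [openGraph, SimpleGraph.edgeSet_fromEdgeSet] at heG ⊢
    exact ⟨heG.1.1, heG.2⟩
  by_cases hvt : v = t
  · exact hvt ▸ hcv
  refine hcv.trans (SimpleGraph.Adj.reachable ?_)
  rw [openGraph_adj]
  refine ⟨⟨a, ha, ?_⟩, hvt⟩
  exact (Sym2.mem_and_mem_iff hvt).1 ⟨hva, hta⟩

/-- **Cross transfer.** Let `t₁, t₂` be the two terminals, `t₁` without open port, and let `x₁, x₂` be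
two configurations such that `x₁` agrees with `z` on the labels touching `R(z)` (as far as openness is
concerned) and `x₂` is the complement of `x₁` off those labels. Then an `x₁`-open PATH from a vertex
outside `R(z)` to `t₂` never meets `R(z)`, so it is an `x₂`-CLOSED path. [this work] -/
theorem cross_transfer (z x₁ x₂ : α → Bool) (hcs : c ≠ s) (hcb : c ≠ b) {t₁ t₂ : V}
    (ht₁ : t₁ = s ∨ t₁ = b) (ht₂ : t₂ = s ∨ t₂ = b) (h12 : t₁ ≠ t₂)
    (hport : ¬ PortOpen ends s b c z t₁)
    (H1 : ∀ a, x₁ a = true → Touch ends s b c z a → z a = true)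
    (H2 : ∀ a, ¬ Touch ends s b c z a → x₂ a = !x₁ a)
    {u : V} (p : (openGraph (labelledOpen ends x₁)).Walk u t₂) (hp : p.IsPath)
    (hu : ¬ PReach ends s b c z u) :
    (openGraph (labelledOpen ends fun a => !x₂ a)).Reachable u t₂ := by
  induction p with
  | nil => exact SimpleGraph.Reachable.refl _
  | @cons u x w hadj p ih =>
    rw [SimpleGraph.Walk.cons_isPath_iff] at hp
    obtain ⟨hp', hus⟩ := hp
    -- u ≠ t₂ = w (end of the remaining path)
    have hut₂ : u ≠ w := fun h => hus (h ▸ p.end_mem_support)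
    rw [openGraph_adj] at hadj
    obtain ⟨⟨a, ha, hends⟩, hux⟩ := hadj
    -- the next vertex is outside R(z)
    have hx : ¬ PReach ends s b c z x := by
      intro hx
      have hza : z a = true := H1 a ha ⟨x, by rw [hends]; exact Sym2.mem_mk_right _ _, hx⟩
      have hu' := terminal_of_open_label ends s b c z hcs hcb hza
        (hends.trans (Sym2.eq_swap)) hx hu
      -- u is a terminal ≠ t₂, so u = t₁, and `a` is an open port at t₁
      have hut₁ : u = t₁ := by
        rcases hu' with rfl | rfl <;> rcases ht₁ with rfl | rfl <;> rcases ht₂ with rfl | rfl <;>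
          first | rfl | exact absurd rfl h12 | exact absurd rfl hut₂
      exact hport ⟨a, hza, by rw [hends, hut₁]; exact Sym2.mem_mk_left _ _,
        x, by rw [hends]; exact Sym2.mem_mk_right _ _, hx⟩
    have hnt : ¬ Touch ends s b c z a := by
      rintro ⟨v, hv, hRv⟩
      rw [hends, Sym2.mem_iff] at hv
      rcases hv with rfl | rfl
      exacts [hu hRv, hx hRv]
    have hx₂a : (fun a => !x₂ a) a = true := by
      show (!x₂ a) = true
      rw [H2 a hnt, ha]; rfl
    refine SimpleGraph.Reachable.trans (SimpleGraph.Adj.reachable ?_) (ih ht₂ h12 hp' hx)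
    rw [openGraph_adj]
    exact ⟨⟨a, hx₂a, hends⟩, hux⟩

/-- **Open connection of the port survives the far flip.** If `c ↔ {s,b}` in the open graph of `z`
then `c ↔ {s,b}` in the open graph of `ι₀(z)`. [this work] -/
theorem Y_farFlip (z : α → Bool) (hcs : c ≠ s) (hcb : c ≠ b)
    (hY : (openGraph (labelledOpen ends z)).Reachable c s ∨
      (openGraph (labelledOpen ends z)).Reachable c b) :
    (openGraph (labelledOpen ends (farFlip ends s b c z))).Reachable c s ∨
      (openGraph (labelledOpen ends (farFlip ends s b c z))).Reachable c b := by
  -- walk from an R-vertex u (z'-reachable from c) to a terminal: follow it until it leaves R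
  have key : ∀ {u t : V} (p : (openGraph (labelledOpen ends z)).Walk u t), (t = s ∨ t = b) →
      PReach ends s b c z u →
      (openGraph (labelledOpen ends (farFlip ends s b c z))).Reachable c u →
      (openGraph (labelledOpen ends (farFlip ends s b c z))).Reachable c s ∨
        (openGraph (labelledOpen ends (farFlip ends s b c z))).Reachable c b := by
    intro u t p
    induction p with
    | nil =>
      intro ht hu _
      exact absurd ht (not_or.mpr (preach_ne ends s b c z hcs hcb hu))
    | @cons u x t hadj p ih =>
      intro ht hu hcu
      rw [openGraph_adj] at hadj
      obtain ⟨⟨a, ha, hends⟩, hux⟩ := hadj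
      have htouch : Touch ends s b c z a := ⟨u, by rw [hends]; exact Sym2.mem_mk_left _ _, hu⟩
      have ha' : farFlip ends s b c z a = true := by rw [farFlip_of_touch ends s b c z htouch, ha]
      have hcx : (openGraph (labelledOpen ends (farFlip ends s b c z))).Reachable c x := by
        refine hcu.trans (SimpleGraph.Adj.reachable ?_)
        rw [openGraph_adj]; exact ⟨⟨a, ha', hends⟩, hux⟩
      by_cases hxs : x = s
      · exact Or.inl (hxs ▸ hcx)
      by_cases hxb : x = b
      · exact Or.inr (hxb ▸ hcx)
      exact ih ht (preach_step ends s b c z hcs hcb ha hends hu hxs hxb) hcx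
  rcases hY with hY | hY
  · obtain ⟨p⟩ := hY
    exact key p (Or.inl rfl) (preach_self ends s b c z) (SimpleGraph.Reachable.refl _)
  · obtain ⟨p⟩ := hY
    exact key p (Or.inr rfl) (preach_self ends s b c z) (SimpleGraph.Reachable.refl _)

/-- **Theorem A (validity of the far flip).** If `c ∉ {s,b}`, `c ↔ {s,b}` and `s ↔ b` in the open graph of
`z`, `s ↮ b` in the closed graph of `z`, and the punctured open cluster of `c` is one-sided, then in
`ι₀(z)`: `c ↔ {s,b}` (open), `s ↮ b` (open) and `s ↔ b` (closed). [this work] -/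
theorem farFlip_mem_X5 (z : α → Bool) (hcs : c ≠ s) (hcb : c ≠ b) (hsb : s ≠ b)
    (hY : (openGraph (labelledOpen ends z)).Reachable c s ∨
      (openGraph (labelledOpen ends z)).Reachable c b)
    (hJ : (openGraph (labelledOpen ends z)).Reachable s b)
    (hD : ¬ (openGraph (labelledOpen ends fun a => !z a)).Reachable s b)
    (h1 : OneSided ends s b c z) :
    ((openGraph (labelledOpen ends (farFlip ends s b c z))).Reachable c s ∨
      (openGraph (labelledOpen ends (farFlip ends s b c z))).Reachable c b) ∧
    ¬ (openGraph (labelledOpen ends (farFlip ends s b c z))).Reachable s b ∧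
    (openGraph (labelledOpen ends fun a => !(farFlip ends s b c z) a)).Reachable s b := by
  classical
  -- the terminal without open port
  have hex : ∃ t₁ t₂ : V, (t₁ = s ∨ t₁ = b) ∧ (t₂ = s ∨ t₂ = b) ∧ t₁ ≠ t₂ ∧
      ¬ PortOpen ends s b c z t₁ := by
    unfold OneSided at h1
    by_cases hs : PortOpen ends s b c z s
    · exact ⟨b, s, Or.inr rfl, Or.inl rfl, hsb.symm, fun hb => h1 ⟨hs, hb⟩⟩
    · exact ⟨s, b, Or.inl rfl, Or.inr rfl, hsb, hs⟩
  obtain ⟨t₁, t₂, ht₁, ht₂, h12, hport⟩ := hex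
  have hnot₁ : ¬ PReach ends s b c z t₁ := fun h =>
    absurd (eq_of_preach_terminal ends s b c z ht₁ h) (by rcases ht₁ with rfl | rfl <;> assumption)
  -- symmetric reachability between the two terminals
  have symm : ∀ (G : SimpleGraph V), G.Reachable s b ↔ G.Reachable t₁ t₂ := by
    intro G
    rcases ht₁ with rfl | rfl <;> rcases ht₂ with rfl | rfl
    · exact absurd rfl h12
    · exact Iff.rfl
    · exact ⟨fun h => h.symm, fun h => h.symm⟩
    · exact absurd rfl h12
  refine ⟨Y_farFlip ends s b c z hcs hcb hY, ?_, ?_⟩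
  · -- ¬J: an open path of ι₀(z) from t₁ to t₂ would be a closed path of z
    intro hJ'
    obtain ⟨p⟩ := (symm _).1 hJ'
    have h := cross_transfer ends s b c z (farFlip ends s b c z) z hcs hcb ht₁ ht₂ h12 hport
      (fun a ha ht => by rw [farFlip_of_touch ends s b c z ht] at ha; exact ha)
      (fun a hnt => by rw [farFlip_of_not_touch ends s b c z hnt, Bool.not_not])
      p.bypass p.bypass_isPath hnot₁
    exact hD ((symm _).2 h)
  · -- ¬D: the open path of z from t₁ to t₂ becomes a closed path of ι₀(z)
    obtain ⟨p⟩ := (symm _).1 hJ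
    have h := cross_transfer ends s b c z z (farFlip ends s b c z) hcs hcb ht₁ ht₂ h12 hport
      (fun a ha _ => ha) (fun a hnt => farFlip_of_not_touch ends s b c z hnt)
      p.bypass p.bypass_isPath hnot₁
    exact (symm _).2 h

/-- A configuration with `c ↔ {s,b}` but `s ↮ b` (open) is one-sided: two open ports would join
`s` to `b` through the punctured cluster. [this work] -/
theorem oneSided_of_not_reachable (z : α → Bool)
    (hJ : ¬ (openGraph (labelledOpen ends z)).Reachable s b) : OneSided ends s b c z := by
  rintro ⟨hs, hb⟩
  exact hJ ((reachable_of_portOpen ends s b c z hs).symm.trans (reachable_of_portOpen ends s b c z hb))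

end Validity


end Summit.CriticalPhenomena.PercolationContinuityZ3.Theorems.ThreePointCPIPunctured
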